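import Summits.AtomisticToContinuum.HydrodynamicLimit.Theorems.CollisionIsometryCLTAdaptedWeightCLTBHCoarsening
import Summits.AtomisticToContinuum.HydrodynamicLimit.Theorems.CollisionIsometryCLTAdaptedWeightCLTSAReynoldsGauss

/-!
# Equilibrium rung of `stub_reynoldsBH` (line `block-h-dissipation-closure`, crux stmt-AtomisticToContinuum-14868):
# the smeared sub-block Reynolds product of ONE configuration, pointwise

Support file (`--supports stmt-AtomisticToContinuum-14868`, anchor `bhReynoldsBH_pointwise_anchor`) of the stub worker
of `stub_reynoldsBH` (the sub-block Reynolds remainder `SubBlockReynoldsOn` of the Germano split, the line's declared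
hydro-class exposure); first file of its EQUILIBRIUM RUNG (constant profiles, every flow), the ψ-SMEARED twin of the
rung `…SAReynolds{Packing,Gauss,Statics,Dynamics}` of `SustainedAnisotropy.stub_reynolds`.

This file is measure-free in the velocities: for ONE configuration `w` and ONE block centre `x` it bounds the
Reynolds product `ethG · reyG` (`…BHCoarseningGermanoPointwise`) LINEARLY by two smeared functionals whose Gaussian
expectations are computable cell by cell (`…BHReynoldsBHGauss`):

  `ethG · reyG ≤ rtwoG / (2ε) + ε (16 m₀³ + 4 m₀) envG`   for every `ε > 0`   (`ethG_mul_reyG_le`),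

`m₀ = massG = (N+1)⁻¹ Σᵢ φ_N(xᵢ − x)` the block mass, `rtwoG = ν(|ū_ψ(x') − ū_φ(x)|²)` the QUADRATIC smeared
fluctuation (small in the mean at equilibrium: thermal cell noise) and `envG = ν(3 + 2|vᵢ − ū_ψ(x')|¹⁶ + |ū_ψ(x') − ū_φ(x)|¹⁶)`
a sixteenth-moment envelope (bounded in the mean), where `ν(K) = ∫ dx' (N+1)⁻¹ Σᵢ φ_N(xᵢ − x) ψ_N(xᵢ − x') Kᵢ(x', ū_ψ(x'))`
is the smeared block functional (`ReynoldsBH.nuG`, total mass `ν(1) = m₀` by the unit mass of `ψ_N`).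
Steps: the AM–GM family under `ν` with the POINT-DEPENDENT parameter `s = (ε · ethG)⁻¹`, `ethG² V ≤ (ethG⁴ + V²)/2`,
the power means `ν(K)⁴ ≤ m₀³ ν(K⁴)`, `ν(K)² ≤ m₀ ν(K²)` (tangent-line form, linearity of `ν` only) and the polynomial
envelopes `(1 + a² + a⁴ + d²)⁴ ≤ 64 (3 + 2a¹⁶ + d¹⁶)`, `(d + d³)⁴ ≤ 16 (3 + 2a¹⁶ + d¹⁶)`. No Cauchy–Schwarz, no square root.
-/

namespace Summit.AtomisticToContinuum.HydrodynamicLimit.Theorems.BlockHDissipation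

open scoped BigOperators Topology Classical MeasureTheory ENNReal InnerProductSpace
open Filter Set MeasureTheory
open Literature.Analysis.FluidPDE Literature.Analysis.FluidPDE.Torus
open Summit.AtomisticToContinuum.HydrodynamicLimit.Theorems.ContactSourceDuhamel
open Summit.AtomisticToContinuum.HydrodynamicLimit.Theorems.ContactSourceDuhamel.TimeLocal
open Summit.AtomisticToContinuum.HydrodynamicLimit.Theorems.ContactBalance
open Summit.AtomisticToContinuum.HydrodynamicLimit.Theorems.SustainedAnisotropy

noncomputable section

/-! ## The auxiliary smeared functionals -/

/-- The BLOCK MASS `m₀ = (N+1)⁻¹ Σᵢ φ_N(xᵢ − x)` of a configuration at `x` (`= W/(N+1)`). -/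
def massG (N : ℕ) (φ : ℕ → T3 → ℝ) (w : Cfg N) (x : T3) : ℝ :=
  ((N + 1 : ℕ) : ℝ)⁻¹ * ∑ i : Fin (N + 1), wgtC N φ w x i

/-- The QUADRATIC smeared sub-block fluctuation at `x`: `∫ dx' (N+1)⁻¹ Σᵢ φ_N(xᵢ − x) ψ_N(xᵢ − x') |ū_ψ(x') − ū_φ(x)|²`
(the quadratic half of `reyG`; conditional mean `≍ θ · (self-share of the ψ-cells)` at equilibrium). -/
def rtwoG (N : ℕ) (φ ψ : ℕ → T3 → ℝ) (w : Cfg N) (x : T3) : ℝ :=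
  ∫ x', ((N + 1 : ℕ) : ℝ)⁻¹ * ∑ i : Fin (N + 1), wgtC N φ w x i * (wgtC N ψ w x' i *
    ‖ubarC N ψ w x' - ubarC N φ w x‖ ^ 2)

/-- The SIXTEENTH-MOMENT ENVELOPE at `x`:
`∫ dx' (N+1)⁻¹ Σᵢ φ_N(xᵢ − x) ψ_N(xᵢ − x') (3 + 2 |vᵢ − ū_ψ(x')|¹⁶ + |ū_ψ(x') − ū_φ(x)|¹⁶)` (dominates `ν(U⁴)/64` and
`ν((|δ| + |δ|³)⁴)/16`; bounded conditional mean at equilibrium). -/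
def envG (N : ℕ) (φ ψ : ℕ → T3 → ℝ) (w : Cfg N) (x : T3) : ℝ :=
  ∫ x', ((N + 1 : ℕ) : ℝ)⁻¹ * ∑ i : Fin (N + 1), wgtC N φ w x i * (wgtC N ψ w x' i *
    (3 + 2 * ‖(w i).2 - ubarC N ψ w x'‖ ^ 16 + ‖ubarC N ψ w x' - ubarC N φ w x‖ ^ 16))

namespace ReynoldsBH

/-- The SMEARED BLOCK FUNCTIONAL `ν(K) = ∫ dx' (N+1)⁻¹ Σᵢ φ_N(xᵢ − x) ψ_N(xᵢ − x') Kᵢ(x', ū_ψ(x'))` of a family of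
tests `Kᵢ` of the cell centre and the cell velocity (a positive linear functional of total mass `m₀`). -/
def nuG (N : ℕ) (φ ψ : ℕ → T3 → ℝ) (w : Cfg N) (x : T3) (K : Fin (N + 1) → T3 → V3 → ℝ) : ℝ :=
  ∫ x', ((N + 1 : ℕ) : ℝ)⁻¹ * ∑ i : Fin (N + 1), wgtC N φ w x i * (wgtC N ψ w x' i * K i x' (ubarC N ψ w x'))

/-! ## Scalar inequalities -/

/-- The two polynomial envelopes (`a, d ≥ 0`): `(1 + a² + a⁴ + d²)⁴ ≤ 64 (3 + 2a¹⁶ + d¹⁶)` (energy weight) and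
`((d + d³)²)² ≤ 16 (3 + 2a¹⁶ + d¹⁶)` (Reynolds weight) — power means and `yᵏ ≤ 1 + y¹⁶`. -/
theorem env_le {a d : ℝ} (ha : 0 ≤ a) (hd : 0 ≤ d) :
    (1 + a ^ 2 + a ^ 4 + d ^ 2) ^ 4 ≤ 64 * (3 + 2 * a ^ 16 + d ^ 16) ∧
    ((d + d ^ 3) ^ 2) ^ 2 ≤ 16 * (3 + 2 * a ^ 16 + d ^ 16) := by
  -- `yᵏ ≤ 1 + y¹⁶` for `y ≥ 0`, `k ≤ 16`
  have hp : ∀ y : ℝ, 0 ≤ y → ∀ k : ℕ, k ≤ 16 → y ^ k ≤ 1 + y ^ 16 := fun y hy k hk => by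
    rcases le_total y 1 with h1 | h1
    · exact (pow_le_one₀ hy h1).trans (le_add_of_nonneg_right (by positivity))
    · exact (pow_le_pow_right₀ h1 hk).trans (le_add_of_nonneg_left zero_le_one)
  constructor
  · have h := Reynolds.add_four_pow_four_le (b := a ^ 2) (c := a ^ 4) (e := d ^ 2)
      (by positivity) (by positivity) (by positivity)
    simp only [← pow_mul] at h
    norm_num at h
    linarith [hp a ha 8 (by norm_num), hp d hd 8 (by norm_num)]
  · have h := add_pow_le hd (show 0 ≤ d ^ 3 by positivity) 4
    rw [← pow_mul] at h
    rw [← pow_mul]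
    norm_num at h ⊢
    have ha16 : 0 ≤ a ^ 16 := by positivity
    linarith [hp d hd 4 (by norm_num), hp d hd 12 (by norm_num)]

/-- The AM–GM family for the Reynolds integrand: `y² + y⁴ = y (y + y³) ≤ (t/2) y² + (1/2t) (y + y³)²` (`t > 0`). -/
theorem amgm_rey (y : ℝ) {t : ℝ} (ht : 0 < t) : y ^ 2 + y ^ 4 ≤ t / 2 * y ^ 2 + t⁻¹ / 2 * (y + y ^ 3) ^ 2 := by
  have h := Coarsening.mul_le_amgm (le_refl (y ^ 2)) (le_refl ((y + y ^ 3) ^ 2)) ht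
  have e : y ^ 2 + y ^ 4 = y * (y + y ^ 3) := by ring
  rw [e]
  exact h

/-- The tangent-line form of the quartic power mean: `K⁴ − 4c³K + 3c⁴ = (K − c)²(K² + 2cK + 3c²) ≥ 0` (`K, c ≥ 0`). -/
theorem quartic_tangent {K c : ℝ} (hK : 0 ≤ K) (hc : 0 ≤ c) : 0 ≤ K ^ 4 - 4 * c ^ 3 * K + 3 * c ^ 4 := by
  have e : K ^ 4 - 4 * c ^ 3 * K + 3 * c ^ 4 = (K - c) ^ 2 * (K ^ 2 + 2 * c * K + 3 * c ^ 2) := by ring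
  rw [e]
  exact mul_nonneg (sq_nonneg _) (by positivity)

/-! ## The smeared block functional `ν` -/

section Nu

variable {N : ℕ} {φ ψ : ℕ → T3 → ℝ} (hψc : Continuous (ψ N)) (hψ0 : ∀ y, 0 ≤ ψ N y) (hψ1 : ∫ y, ψ N y = 1)
  (hφ0 : ∀ y, 0 ≤ φ N y) (w : Cfg N) (x : T3)

/-- The dictionary `ethG = ν(1 + |vᵢ − z|² + |vᵢ − z|⁴ + |z − ū_φ(x)|²)`. -/
theorem ethG_eq_nuG : ethG N φ ψ w x = nuG N φ ψ w x
    (fun i _ z => 1 + ‖(w i).2 - z‖ ^ 2 + ‖(w i).2 - z‖ ^ 4 + ‖z - ubarC N φ w x‖ ^ 2) := rfl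

/-- The dictionary `reyG = ν(|z − ū_φ(x)|² + |z − ū_φ(x)|⁴)`. -/
theorem reyG_eq_nuG : reyG N φ ψ w x = nuG N φ ψ w x
    (fun _ _ z => ‖z - ubarC N φ w x‖ ^ 2 + ‖z - ubarC N φ w x‖ ^ 4) := rfl

/-- The dictionary `rtwoG = ν(|z − ū_φ(x)|²)`. -/
theorem rtwoG_eq_nuG : rtwoG N φ ψ w x = nuG N φ ψ w x (fun _ _ z => ‖z - ubarC N φ w x‖ ^ 2) := rfl

/-- The dictionary `envG = ν(3 + 2|vᵢ − z|¹⁶ + |z − ū_φ(x)|¹⁶)`. -/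
theorem envG_eq_nuG : envG N φ ψ w x = nuG N φ ψ w x
    (fun i _ z => 3 + 2 * ‖(w i).2 - z‖ ^ 16 + ‖z - ubarC N φ w x‖ ^ 16) := rfl

include hψc hψ0 in
/-- The integrand of `ν(K)` is integrable in the cell centre for jointly continuous tests. -/
theorem integrable_nuG {K : Fin (N + 1) → T3 → V3 → ℝ} (hK : ∀ i, Continuous (Function.uncurry (K i))) :
    Integrable fun x' => ((N + 1 : ℕ) : ℝ)⁻¹ * ∑ i : Fin (N + 1), wgtC N φ w x i *
      (wgtC N ψ w x' i * K i x' (ubarC N ψ w x')) :=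
  Coarsening.integrable_avg hψc hψ0 w (fun i => wgtC N φ w x i) hK

include hψ0 hφ0 in
/-- `ν` is positive. -/
theorem nuG_nonneg {K : Fin (N + 1) → T3 → V3 → ℝ} (h0 : ∀ i x' z, 0 ≤ K i x' z) : 0 ≤ nuG N φ ψ w x K :=
  integral_nonneg fun x' => mul_nonneg (by positivity) (Finset.sum_nonneg fun i _ =>
    mul_nonneg (hφ0 _) (mul_nonneg (hψ0 _) (h0 i x' _)))

include hψc hψ0 hφ0 in
/-- `ν` is monotone. -/
theorem nuG_mono {K K' : Fin (N + 1) → T3 → V3 → ℝ} (hK : ∀ i, Continuous (Function.uncurry (K i)))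
    (hK' : ∀ i, Continuous (Function.uncurry (K' i))) (hle : ∀ i x' z, K i x' z ≤ K' i x' z) :
    nuG N φ ψ w x K ≤ nuG N φ ψ w x K' :=
  integral_mono (integrable_nuG hψc hψ0 w x hK) (integrable_nuG hψc hψ0 w x hK') fun x' =>
    mul_le_mul_of_nonneg_left (Finset.sum_le_sum fun i _ => mul_le_mul_of_nonneg_left
      (mul_le_mul_of_nonneg_left (hle i x' _) (hψ0 _)) (hφ0 _)) (by positivity)

/-- `ν` is homogeneous: `ν(c K) = c ν(K)`. -/
theorem nuG_const_mul (c : ℝ) (K : Fin (N + 1) → T3 → V3 → ℝ) :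
    nuG N φ ψ w x (fun i x' z => c * K i x' z) = c * nuG N φ ψ w x K := by
  unfold nuG
  rw [← integral_const_mul]
  refine integral_congr_ae (ae_of_all _ fun x' => ?_)
  simp only [Finset.mul_sum]
  exact Finset.sum_congr rfl fun i _ => by ring

include hφ0 in
/-- The block mass is nonnegative. -/
theorem massG_nonneg : 0 ≤ massG N φ w x :=
  mul_nonneg (by positivity) (Finset.sum_nonneg fun i _ => hφ0 _)

include hψ1 in
/-- The total mass of `ν`: `ν(1) = m₀` (unit mass of the cell kernel). -/
theorem nuG_one : nuG N φ ψ w x (fun _ _ _ => 1) = massG N φ w x := by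
  unfold nuG massG
  have hint : ∀ i : Fin (N + 1), Integrable fun x' => wgtC N φ w x i * (wgtC N ψ w x' i * 1) := fun i =>
    ((Integrable.of_integral_ne_zero (by rw [Coarsening.integral_wgtC_right hψ1 w i]; exact one_ne_zero)
      ).mul_const _).const_mul _
  rw [integral_const_mul, integral_finsetSum _ fun i _ => hint i]
  congr 1
  refine Finset.sum_congr rfl fun i _ => ?_
  rw [integral_const_mul, integral_mul_const, Coarsening.integral_wgtC_right hψ1 w i, mul_one, mul_one]

include hψc hψ0 in
/-- `ν` is additive: `ν(K₁ + K₂) = ν(K₁) + ν(K₂)`. -/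
theorem nuG_add {K₁ K₂ : Fin (N + 1) → T3 → V3 → ℝ} (hK₁ : ∀ i, Continuous (Function.uncurry (K₁ i)))
    (hK₂ : ∀ i, Continuous (Function.uncurry (K₂ i))) :
    nuG N φ ψ w x (fun i x' z => K₁ i x' z + K₂ i x' z) = nuG N φ ψ w x K₁ + nuG N φ ψ w x K₂ := by
  unfold nuG
  rw [← integral_add (integrable_nuG hψc hψ0 w x hK₁) (integrable_nuG hψc hψ0 w x hK₂)]
  refine integral_congr_ae (ae_of_all _ fun x' => ?_)
  simp only [Finset.mul_sum, ← Finset.sum_add_distrib]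
  exact Finset.sum_congr rfl fun i _ => by ring

include hψ1 in
/-- `ν` of a constant: `ν(γ) = γ m₀`. -/
theorem nuG_const (γ : ℝ) : nuG N φ ψ w x (fun _ _ _ => γ) = γ * massG N φ w x := by
  rw [← nuG_one hψ1 w x, ← nuG_const_mul]
  simp only [mul_one]

include hψc hψ0 hψ1 in
/-- `ν` is linear: `ν(α K₁ + β K₂ + γ) = α ν(K₁) + β ν(K₂) + γ m₀`. -/
theorem nuG_lin {K₁ K₂ : Fin (N + 1) → T3 → V3 → ℝ} (hK₁ : ∀ i, Continuous (Function.uncurry (K₁ i)))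
    (hK₂ : ∀ i, Continuous (Function.uncurry (K₂ i))) (α β γ : ℝ) :
    nuG N φ ψ w x (fun i x' z => α * K₁ i x' z + β * K₂ i x' z + γ) =
      α * nuG N φ ψ w x K₁ + β * nuG N φ ψ w x K₂ + γ * massG N φ w x := by
  have hA1 : ∀ i, Continuous (Function.uncurry fun x' z => α * K₁ i x' z) := fun i => (hK₁ i).const_mul α
  have hA2 : ∀ i, Continuous (Function.uncurry fun x' z => β * K₂ i x' z) := fun i => (hK₂ i).const_mul β
  have hA : ∀ i, Continuous (Function.uncurry fun x' z => α * K₁ i x' z + β * K₂ i x' z) := fun i =>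
    (hA1 i).add (hA2 i)
  have hC : ∀ _i : Fin (N + 1), Continuous (Function.uncurry fun (_ : T3) (_ : V3) => γ) := fun _ =>
    continuous_const
  calc nuG N φ ψ w x (fun i x' z => α * K₁ i x' z + β * K₂ i x' z + γ)
      = nuG N φ ψ w x (fun i x' z => α * K₁ i x' z + β * K₂ i x' z) + nuG N φ ψ w x (fun _ _ _ => γ) :=
        nuG_add hψc hψ0 w x hA hC
    _ = nuG N φ ψ w x (fun i x' z => α * K₁ i x' z) + nuG N φ ψ w x (fun i x' z => β * K₂ i x' z) +
          nuG N φ ψ w x (fun _ _ _ => γ) := by rw [nuG_add hψc hψ0 w x hA1 hA2]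
    _ = _ := by rw [nuG_const_mul, nuG_const_mul, nuG_const hψ1]

include hφ0 in
/-- An empty block (`m₀ = 0`) carries no `ν`-mass: `ν(K) = 0`. -/
theorem nuG_eq_zero_of_massG_eq_zero (hm : massG N φ w x = 0) (K : Fin (N + 1) → T3 → V3 → ℝ) :
    nuG N φ ψ w x K = 0 := by
  have hsum : ∑ i : Fin (N + 1), wgtC N φ w x i = 0 :=
    (mul_eq_zero.1 hm).resolve_left (by positivity)
  have ha : ∀ i, wgtC N φ w x i = 0 := fun i =>
    (Finset.sum_eq_zero_iff_of_nonneg fun j _ => hφ0 _).1 hsum i (Finset.mem_univ i)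
  unfold nuG
  simp [ha]

include hψc hψ0 hψ1 hφ0 in
/-- QUARTIC POWER MEAN for `ν`: `ν(K)⁴ ≤ m₀³ ν(K⁴)` for `K ≥ 0` (tangent line `K⁴ ≥ 4c³K − 3c⁴` at `c = ν(K)/m₀`). -/
theorem nuG_pow_four_le {K : Fin (N + 1) → T3 → V3 → ℝ} (hK : ∀ i, Continuous (Function.uncurry (K i)))
    (hK0 : ∀ i x' z, 0 ≤ K i x' z) :
    nuG N φ ψ w x K ^ 4 ≤ massG N φ w x ^ 3 * nuG N φ ψ w x (fun i x' z => K i x' z ^ 4) := by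
  set I₁ := nuG N φ ψ w x K with hI₁
  set I₄ := nuG N φ ψ w x (fun i x' z => K i x' z ^ 4) with hI₄
  set m := massG N φ w x with hm
  have hm0 : 0 ≤ m := massG_nonneg hφ0 w x
  have hI₁0 : 0 ≤ I₁ := nuG_nonneg hψ0 hφ0 w x hK0
  have hK4 : ∀ i, Continuous (Function.uncurry fun x' z => K i x' z ^ 4) := fun i => (hK i).pow 4
  -- the tangent line, integrated
  have key : ∀ c : ℝ, 0 ≤ c → 0 ≤ I₄ - 4 * c ^ 3 * I₁ + 3 * c ^ 4 * m := by
    intro c hc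
    have h := nuG_nonneg hψ0 hφ0 w x (K := fun i x' z => (1 : ℝ) * K i x' z ^ 4 + (-(4 * c ^ 3)) * K i x' z +
      3 * c ^ 4) fun i x' z => by have := quartic_tangent (hK0 i x' z) hc; linarith
    rw [nuG_lin hψc hψ0 hψ1 w x hK4 hK (1 : ℝ) (-(4 * c ^ 3)) (3 * c ^ 4)] at h
    rw [hI₄, hI₁, hm]
    linarith
  rcases hm0.eq_or_lt with hm00 | hmpos
  · have h0 : I₁ = 0 := nuG_eq_zero_of_massG_eq_zero hφ0 w x hm00.symm K
    rw [h0, ← hm00]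
    simp
  · have h := key (I₁ / m) (div_nonneg hI₁0 hmpos.le)
    have e1 : 4 * (I₁ / m) ^ 3 * I₁ = 4 * (I₁ ^ 4 / m ^ 3) := by field_simp
    have e2 : 3 * (I₁ / m) ^ 4 * m = 3 * (I₁ ^ 4 / m ^ 3) := by field_simp
    rw [e1, e2] at h
    have h3 : I₁ ^ 4 / m ^ 3 ≤ I₄ := by linarith
    rw [div_le_iff₀ (pow_pos hmpos 3)] at h3
    linarith

include hψc hψ0 hψ1 hφ0 in
/-- QUADRATIC POWER MEAN for `ν`: `ν(K)² ≤ m₀ ν(K²)` (tangent line `K² ≥ 2cK − c²` at `c = ν(K)/m₀`). -/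
theorem nuG_sq_le {K : Fin (N + 1) → T3 → V3 → ℝ} (hK : ∀ i, Continuous (Function.uncurry (K i)))
    (hK0 : ∀ i x' z, 0 ≤ K i x' z) :
    nuG N φ ψ w x K ^ 2 ≤ massG N φ w x * nuG N φ ψ w x (fun i x' z => K i x' z ^ 2) := by
  set I₁ := nuG N φ ψ w x K with hI₁
  set I₂ := nuG N φ ψ w x (fun i x' z => K i x' z ^ 2) with hI₂
  set m := massG N φ w x with hm
  have hm0 : 0 ≤ m := massG_nonneg hφ0 w x
  have hI₁0 : 0 ≤ I₁ := nuG_nonneg hψ0 hφ0 w x hK0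
  have hK2 : ∀ i, Continuous (Function.uncurry fun x' z => K i x' z ^ 2) := fun i => (hK i).pow 2
  have key : ∀ c : ℝ, 0 ≤ I₂ - 2 * c * I₁ + c ^ 2 * m := by
    intro c
    have h := nuG_nonneg hψ0 hφ0 w x (K := fun i x' z => (1 : ℝ) * K i x' z ^ 2 + (-(2 * c)) * K i x' z +
      c ^ 2) fun i x' z => by nlinarith [sq_nonneg (K i x' z - c)]
    rw [nuG_lin hψc hψ0 hψ1 w x hK2 hK (1 : ℝ) (-(2 * c)) (c ^ 2)] at h
    rw [hI₂, hI₁, hm]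
    linarith
  rcases hm0.eq_or_lt with hm00 | hmpos
  · have h0 : I₁ = 0 := nuG_eq_zero_of_massG_eq_zero hφ0 w x hm00.symm K
    rw [h0, ← hm00]
    simp
  · have h := key (I₁ / m)
    have e1 : 2 * (I₁ / m) * I₁ = 2 * (I₁ ^ 2 / m) := by field_simp
    have e2 : (I₁ / m) ^ 2 * m = I₁ ^ 2 / m := by field_simp
    rw [e1, e2] at h
    have h3 : I₁ ^ 2 / m ≤ I₂ := by linarith
    rw [div_le_iff₀ hmpos] at h3
    linarith

end Nu

/-! ## The pointwise bound of the Reynolds product -/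

section Main

variable {N : ℕ} {φ ψ : ℕ → T3 → ℝ} (hψc : Continuous (ψ N)) (hψ0 : ∀ y, 0 ≤ ψ N y) (hψ1 : ∫ y, ψ N y = 1)
  (hφ0 : ∀ y, 0 ≤ φ N y) (w : Cfg N) (x : T3)

include hψc hψ0 hψ1 hφ0 in
/-- STEP 1 (the AM–GM family under `ν`): `reyG ≤ (s/2) rtwoG + (1/2s) ν((|δ| + |δ|³)²)` for every `s > 0`. -/
theorem reyG_le_amgm {s : ℝ} (hs : 0 < s) :
    reyG N φ ψ w x ≤ s / 2 * rtwoG N φ ψ w x + s⁻¹ / 2 * nuG N φ ψ w x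
      (fun _ _ z => ((‖z - ubarC N φ w x‖ + ‖z - ubarC N φ w x‖ ^ 3) ^ 2)) := by
  rw [reyG_eq_nuG, rtwoG_eq_nuG]
  have h := nuG_mono hψc hψ0 hφ0 w x
    (K := fun _ _ z => ‖z - ubarC N φ w x‖ ^ 2 + ‖z - ubarC N φ w x‖ ^ 4)
    (K' := fun (_ : Fin (N + 1)) (_ : T3) z => s / 2 * ‖z - ubarC N φ w x‖ ^ 2 +
      s⁻¹ / 2 * ((‖z - ubarC N φ w x‖ + ‖z - ubarC N φ w x‖ ^ 3) ^ 2) + 0)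
    (fun i => by fun_prop) (fun i => by fun_prop) (fun i x' z => by
      have := amgm_rey ‖z - ubarC N φ w x‖ hs; linarith)
  rw [nuG_lin hψc hψ0 hψ1 w x (fun i => by fun_prop) (fun i => by fun_prop)] at h
  linarith

include hψc hψ0 hψ1 hφ0 in
/-- STEP 2 (power means and envelopes): `ethG⁴ ≤ 64 m₀³ envG` and `ν((|δ| + |δ|³)²)² ≤ 16 m₀ envG`. -/
theorem pow_four_and_sq_le :
    ethG N φ ψ w x ^ 4 ≤ 64 * massG N φ w x ^ 3 * envG N φ ψ w x ∧
    nuG N φ ψ w x (fun _ _ z => ((‖z - ubarC N φ w x‖ + ‖z - ubarC N φ w x‖ ^ 3) ^ 2)) ^ 2 ≤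
      16 * massG N φ w x * envG N φ ψ w x := by
  have hm0 := massG_nonneg hφ0 w x
  constructor
  · rw [ethG_eq_nuG, envG_eq_nuG]
    have h1 := nuG_pow_four_le hψc hψ0 hψ1 hφ0 w x
      (K := fun i _ z => 1 + ‖(w i).2 - z‖ ^ 2 + ‖(w i).2 - z‖ ^ 4 + ‖z - ubarC N φ w x‖ ^ 2)
      (fun i => by fun_prop) (fun i x' z => by positivity)
    have h2 := nuG_mono hψc hψ0 hφ0 w x
      (K := fun i (_ : T3) z => (1 + ‖(w i).2 - z‖ ^ 2 + ‖(w i).2 - z‖ ^ 4 + ‖z - ubarC N φ w x‖ ^ 2) ^ 4)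
      (K' := fun i (_ : T3) z => 64 * (3 + 2 * ‖(w i).2 - z‖ ^ 16 + ‖z - ubarC N φ w x‖ ^ 16))
      (fun i => by fun_prop) (fun i => by fun_prop)
      (fun i x' z => (env_le (norm_nonneg _) (norm_nonneg _)).1)
    rw [nuG_const_mul] at h2
    calc _ ≤ _ := h1
      _ ≤ massG N φ w x ^ 3 * (64 * nuG N φ ψ w x
          (fun i _ z => 3 + 2 * ‖(w i).2 - z‖ ^ 16 + ‖z - ubarC N φ w x‖ ^ 16)) :=
          mul_le_mul_of_nonneg_left h2 (pow_nonneg hm0 3)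
      _ = _ := by ring
  · rw [envG_eq_nuG]
    have h1 := nuG_sq_le hψc hψ0 hψ1 hφ0 w x
      (K := fun (_ : Fin (N + 1)) (_ : T3) z => ((‖z - ubarC N φ w x‖ + ‖z - ubarC N φ w x‖ ^ 3) ^ 2))
      (fun i => by fun_prop) (fun i x' z => by positivity)
    have h2 := nuG_mono hψc hψ0 hφ0 w x
      (K := fun (_ : Fin (N + 1)) (_ : T3) z => ((‖z - ubarC N φ w x‖ + ‖z - ubarC N φ w x‖ ^ 3) ^ 2) ^ 2)
      (K' := fun i (_ : T3) z => 16 * (3 + 2 * ‖(w i).2 - z‖ ^ 16 + ‖z - ubarC N φ w x‖ ^ 16))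
      (fun i => by fun_prop) (fun i => by fun_prop)
      (fun i x' z => (env_le (norm_nonneg ((w i).2 - z)) (norm_nonneg _)).2)
    rw [nuG_const_mul] at h2
    calc _ ≤ _ := h1
      _ ≤ massG N φ w x * (16 * nuG N φ ψ w x
          (fun i _ z => 3 + 2 * ‖(w i).2 - z‖ ^ 16 + ‖z - ubarC N φ w x‖ ^ 16)) :=
          mul_le_mul_of_nonneg_left h2 hm0
      _ = _ := by ring

include hψc hψ0 hψ1 hφ0 in
/-- **THE POINTWISE BOUND OF THE SMEARED REYNOLDS PRODUCT.** For one configuration, one block centre and every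
`ε > 0`: `ethG · reyG ≤ rtwoG/(2ε) + ε (16 m₀³ + 4 m₀) envG`. -/
theorem ethG_mul_reyG_le {ε : ℝ} (hε : 0 < ε) :
    ethG N φ ψ w x * reyG N φ ψ w x ≤
      ε⁻¹ / 2 * rtwoG N φ ψ w x + ε * (16 * massG N φ w x ^ 3 + 4 * massG N φ w x) * envG N φ ψ w x := by
  set E := ethG N φ ψ w x with hE
  set V := nuG N φ ψ w x (fun _ _ z => ((‖z - ubarC N φ w x‖ + ‖z - ubarC N φ w x‖ ^ 3) ^ 2)) with hV
  set m := massG N φ w x with hm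
  have hm0 : 0 ≤ m := massG_nonneg hφ0 w x
  have hE0 : 0 ≤ E := by
    rw [hE, ethG_eq_nuG]; exact nuG_nonneg hψ0 hφ0 w x fun i x' z => by positivity
  have hA0 : 0 ≤ rtwoG N φ ψ w x := by
    rw [rtwoG_eq_nuG]; exact nuG_nonneg hψ0 hφ0 w x fun i x' z => by positivity
  have henv0 : 0 ≤ envG N φ ψ w x := by
    rw [envG_eq_nuG]; exact nuG_nonneg hψ0 hφ0 w x fun i x' z => by positivity
  have hV0 : 0 ≤ V := nuG_nonneg hψ0 hφ0 w x fun i x' z => by positivity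
  obtain ⟨h4, h2⟩ := pow_four_and_sq_le hψc hψ0 hψ1 hφ0 w x
  -- `E² V ≤ (E⁴ + V²)/2 ≤ (32 m³ + 8 m) envG`
  have hEV : E ^ 2 * V ≤ (32 * m ^ 3 + 8 * m) * envG N φ ψ w x := by
    nlinarith [sq_nonneg (E ^ 2 - V)]
  rcases hE0.eq_or_lt with hE00 | hEpos
  · rw [← hE00, zero_mul]; positivity
  · have hs : 0 < (ε * E)⁻¹ := by positivity
    have h1 := reyG_le_amgm hψc hψ0 hψ1 hφ0 w x hs
    rw [inv_inv] at h1
    have h3 : E * reyG N φ ψ w x ≤ E * ((ε * E)⁻¹ / 2 * rtwoG N φ ψ w x + ε * E / 2 * V) :=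
      mul_le_mul_of_nonneg_left h1 hE0
    have e1 : E * ((ε * E)⁻¹ / 2 * rtwoG N φ ψ w x + ε * E / 2 * V) =
        ε⁻¹ / 2 * rtwoG N φ ψ w x + ε / 2 * (E ^ 2 * V) := by
      field_simp
    rw [e1] at h3
    have h5 : ε / 2 * (E ^ 2 * V) ≤ ε / 2 * ((32 * m ^ 3 + 8 * m) * envG N φ ψ w x) :=
      mul_le_mul_of_nonneg_left hEV (by positivity)
    calc E * reyG N φ ψ w x ≤ ε⁻¹ / 2 * rtwoG N φ ψ w x + ε / 2 * (E ^ 2 * V) := h3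
      _ ≤ ε⁻¹ / 2 * rtwoG N φ ψ w x + ε / 2 * ((32 * m ^ 3 + 8 * m) * envG N φ ψ w x) := by linarith
      _ = _ := by ring

end Main

end ReynoldsBH

/-- Registered anchor of this helper file (`--supports stmt-AtomisticToContinuum-14868`): the pointwise bound of the
smeared Reynolds product (`ReynoldsBH.ethG_mul_reyG_le`). -/
theorem bhReynoldsBH_pointwise_anchor : ∀ (N : ℕ) (φ ψ : ℕ → T3 → ℝ), Continuous (ψ N) → (∀ y, 0 ≤ ψ N y) → ∫ y, ψ N y = 1 → (∀ y, 0 ≤ φ N y) → ∀ (w : Cfg N) (x : T3) (ε : ℝ), 0 < ε → ethG N φ ψ w x * reyG N φ ψ w x ≤ ε⁻¹ / 2 * rtwoG N φ ψ w x + ε * (16 * massG N φ w x ^ 3 + 4 * massG N φ w x) * envG N φ ψ w x :=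
  fun _ _ _ hψc hψ0 hψ1 hφ0 w x _ hε => ReynoldsBH.ethG_mul_reyG_le hψc hψ0 hψ1 hφ0 w x hε

end

end Summit.AtomisticToContinuum.HydrodynamicLimit.Theorems.BlockHDissipation
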